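import Summits.QuantumFields.BalabanUV.T4Continuum.Support.NE3SmoothRightInverseBounds
import Summits.QuantumFields.BalabanUV.T4Continuum.Support.NE3CovariantWeitzenbock
import Summits.QuantumFields.BalabanUV.T4Continuum.Support.NE3CoercivityScaling
import HarnessLib

/-!
# NE7CutoffLeibniz — THE LEIBNIZ RULES OF A REAL SCALAR CUT-OFF `χ` AGAINST THE DRESSED CURL, THE COVARIANT ∕ FLAT DIVERGENCE, THE GAUGE DIRECTION AND THE STRAIGHT BLOCK
# AVERAGE, WITH THEIR SUP BOUNDS: `curl_V(χY) = χ·curl_V Y + dχ ∧ Y`, `div_V(χY) = χ·div_V Y + ∇χ·Y`, `D_V(χλ) = χ·D_Vλ − (∇χ)λ`, `linQ(χY) = χ(q₀)·linQ Y + linQ((χ − χ(q₀))Y)`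
# — every background `V`, every dimension; the commutators cost `|∇χ|·sup‖Y‖` (memo ROAD-G100 §4 FILES «cut-off calculus on Site d»)

Cell `pub-balaban`, rung (B)+1 sub-cell t4, lineage `b2b-balaban-t4-ne7b-p1`, generation 150 (OWNER of BINDER row NE7b; junction service for the NE crew, ruling R-OWNER-149-1 (2)).
A JUNCTION for row NE7 (node U5): memo `t4/b2b-balaban-t4-ne7-p1-g100/ROAD-G100.md` §4 (the curved sup letter of `𝒯_E(W)` by a bootstrap at a point) cuts the slice element off
with a scalar `χ` (`= 1` on `B(z₀, R∕2)`, `0` off `B(z₀, R)`, `|∇χ| ≤ 2∕R`) and lists among its files «cut-off calculus on `Site d` (products, `curl`, `Q̄`, `∂^*` of `χ·Y`)».  THIS FILE is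
that calculus, background-free: for a real `χ : Site d → ℝ` and a bond field `Y` the product is written `fun x μ ⇒ χ x • Y x μ` (no definition is introduced); `Ad` is real-linear
(`AveragingDeficitNearIdentity.Ad_real_smul`), so every dressed operator of the tree obeys the plain Leibniz rule with a commutator that reads `Y` only NEXT to the point and `χ` only
through its unit differences.  The curved average `Q̄_W` is reached from `linQ` by the tree's comparison `NE3QbarIterCovLift.norm_QbarIter_sub_linQIter_le`; on the bootstrap's fresh
flat torus only `linQ` occurs (`NE3TangentCovariantTower.QbarIter_flat`).
WHAT ([folklore]; 0 def, 0 sorry; every `d`, every coefficient size `n`, every background `V` unless marked unitary).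
§1 identities: **`curlAt_smul_fun`** (`curlAt V (χ•Y) z μ ν = χ z • curlAt V Y z μ ν + (χ(z+e_μ) − χ z) • Ad_{V(z,μ)V(z+e_μ,ν)}(Y(z+e_μ) ν) − (χ(z+e_ν) − χ z) • Ad_{V(z,μ)V(z+e_μ,ν)}(Y(z+e_ν) μ)`),
   **`covDiv_smul_fun`** (`covDiv V (χ•Y) x = χ x • covDiv V Y x + Σ_μ (χ x − χ(x−e_μ)) • Y(x−e_μ) μ`), **`flatDiv_smul_fun`** (the same for `NE3CoercivityScaling.flatDiv`),
   **`gaugeDir_smul_fun`** (`gaugeDir V (χ·λ) x μ = χ x • gaugeDir V λ x μ + (χ x − χ(x+e_μ)) • λ(x+e_μ)`), **`linQ_smul_fun`** (`linQ L (χ•Y) q κ = t • linQ L Y q κ + linQ L ((χ − t)•Y) q κ`, any `t`).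
§2 bounds (`|χ(x+e_μ) − χ x| ≤ g` everywhere, `‖Y‖ ≤ S` near the point; `V` unitary for the dressed ones): **`norm_curlAt_smul_fun_sub_le`** (`≤ 2·g·S`), **`norm_covDiv_smul_fun_sub_le`** (`≤ d·g·S`),
   `norm_flatDiv_smul_fun_sub_le` (`≤ d·g·S`), `norm_gaugeDir_smul_fun_sub_le` (`≤ g·‖λ(x+e_μ)‖`), **`norm_linQ_smul_fun_sub_le`** (`‖linQ L (χ•Y) q κ − t•linQ L Y q κ‖ ≤ L·ω·S` when
   `|χ − t| ≤ ω` and `‖Y‖ ≤ S` on the averaging region of `NE3SmoothRightInverseBounds.norm_linQ_le_of_block`).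
HONEST FRAMING (page 1): pointwise algebra + triangle inequality over the tree's definitions; nothing of Bałaban's asserted; NOT the curved letter, NOT (S1), NOT NE7, nothing of row NE7b;
spine 0∕9; finite T⁴ rung (B)+1 — NOT infinite volume, NOT mass gap, NOT BetaPertH, NOT Clay.  Continuum YM on T⁴ ⇐ BetaPertH ∧ nine spine estimates (0/9 proved); BetaPertH ⇐ (D1) ∧ (D4) ∧
CAP+tail; G-an2-4 gates asym, D1 and NE2/3/4.
-/

set_option autoImplicit false

open scoped BigOperators Matrix.Norms.L2Operator
open Finset

namespace Summit.QuantumFields.BalabanUV.T4Continuum.NE7CutoffLeibniz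

open Literature.MathematicalPhysics.QuantumFieldTheory.Balaban1983to89
open B7Prop1Explicit B7Prop2Explicit
open B7Prop3Flat (linQ linQ_smul)
open T4AveragingDeficitWall (IsUnitaryCfg Ad curlAt)
open AveragingDeficitTransport (norm_Ad_of_unitary)
open AveragingDeficitNearIdentity (Ad_real_smul)
open BlockAveragePushDirGauge (gaugeDir)
open NE3CovariantWeitzenbock (covDiv)
open NE3CoercivityScaling (flatDiv)
open NE3TangentFlatStructure (linQ_sub)
open NE3SmoothRightInverseBounds (norm_linQ_le_of_block)

noncomputable section

variable {d : ℕ} {n : Type*} [Fintype n] [DecidableEq n]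

/-! ## §1 The Leibniz rules (every background) -/

/-- **DRESSED CURL OF A CUT-OFF FIELD** (every `V`): `curl_V(χY)(z;μ,ν) = χ(z)·curl_V Y(z;μ,ν) + (χ(z+e_μ) − χ(z))·Ad(Y(z+e_μ,ν)) − (χ(z+e_ν) − χ(z))·Ad(Y(z+e_ν,μ))` with the
plaquette's own transports. [folklore] -/
theorem curlAt_smul_fun (V : Site d → Fin d → (Matrix n n ℂ)ˣ) (χ : Site d → ℝ) (Y : Site d → Fin d → Matrix n n ℂ) (z : Site d) (μ ν : Fin d) :
    curlAt V (fun x κ => χ x • Y x κ) z μ ν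
      = χ z • curlAt V Y z μ ν
        + ((χ (z + e μ) - χ z) • Ad (V z μ * V (z + e μ) ν) (Y (z + e μ) ν)
          - (χ (z + e ν) - χ z) • Ad (V z μ * V (z + e μ) ν) (Y (z + e ν) μ)) := by
  simp only [curlAt, Ad_real_smul, smul_add, smul_sub, sub_smul]
  abel

/-- **COVARIANT BACKWARD DIVERGENCE OF A CUT-OFF FIELD** (every `V`): `div_V(χY)(x) = χ(x)·div_V Y(x) + Σ_μ (χ(x) − χ(x−e_μ))·Y(x−e_μ, μ)`. [folklore] -/
theorem covDiv_smul_fun (V : Site d → Fin d → (Matrix n n ℂ)ˣ) (χ : Site d → ℝ) (Y : Site d → Fin d → Matrix n n ℂ) (x : Site d) :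
    covDiv V (fun y κ => χ y • Y y κ) x = χ x • covDiv V Y x + ∑ μ : Fin d, (χ x - χ (x - e μ)) • Y (x - e μ) μ := by
  simp only [covDiv, Ad_real_smul, Finset.smul_sum, smul_sub, sub_smul, ← Finset.sum_add_distrib]
  refine Finset.sum_congr rfl fun μ _ => ?_
  abel

omit [Fintype n] [DecidableEq n] in
/-- **FLAT BACKWARD DIVERGENCE OF A CUT-OFF FIELD**: `div(χY)(x) = χ(x)·div Y(x) + Σ_μ (χ(x) − χ(x−e_μ))·Y(x−e_μ, μ)`. [folklore] -/
theorem flatDiv_smul_fun (χ : Site d → ℝ) (Y : Site d → Fin d → Matrix n n ℂ) (x : Site d) :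
    flatDiv (fun y κ => χ y • Y y κ) x = χ x • flatDiv Y x + ∑ μ : Fin d, (χ x - χ (x - e μ)) • Y (x - e μ) μ := by
  simp only [flatDiv, Finset.smul_sum, smul_sub, sub_smul, ← Finset.sum_add_distrib]
  refine Finset.sum_congr rfl fun μ _ => ?_
  abel

/-- **GAUGE DIRECTION OF A CUT-OFF GAUGE FUNCTION** (every `V`): `D_V(χλ)(x,μ) = χ(x)·D_Vλ(x,μ) + (χ(x) − χ(x+e_μ))·λ(x+e_μ)`. [folklore] -/
theorem gaugeDir_smul_fun (V : Site d → Fin d → (Matrix n n ℂ)ˣ) (χ : Site d → ℝ) (lam : Site d → Matrix n n ℂ) (x : Site d) (μ : Fin d) :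
    gaugeDir V (fun y => χ y • lam y) x μ = χ x • gaugeDir V lam x μ + (χ x - χ (x + e μ)) • lam (x + e μ) := by
  simp only [gaugeDir, Ad_real_smul, smul_sub, sub_smul]
  abel

/-- **STRAIGHT BLOCK AVERAGE OF A CUT-OFF FIELD**: `linQ L (χ•Y) q κ = t•linQ L Y q κ + linQ L ((χ − t)•Y) q κ` for every constant `t` (e.g. `t = χ(q)`). [folklore] -/
theorem linQ_smul_fun (L : ℕ) (χ : Site d → ℝ) (t : ℝ) (Y : Site d → Fin d → Matrix n n ℂ) (q : Site d) (κ : Fin d) :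
    linQ L (fun y μ => χ y • Y y μ) q κ = t • linQ L Y q κ + linQ L (fun y μ => (χ y - t) • Y y μ) q κ := by
  have h : (fun y μ => (χ y - t) • Y y μ) = fun y μ => (fun y μ => χ y • Y y μ) y μ - (t • Y) y μ := by
    funext y μ; simp only [Pi.smul_apply, sub_smul]
  rw [h, linQ_sub, linQ_smul, add_sub_cancel]

/-! ## §2 The commutator bounds -/

/-- **THE CURL COMMUTATOR COSTS `2·|∇χ|·sup‖Y‖`** (unitary `V`): `‖curl_V(χY)(z;μ,ν) − χ(z)·curl_V Y(z;μ,ν)‖ ≤ 2·g·S` when `|χ(z+e_κ) − χ(z)| ≤ g` (`κ = μ, ν`) and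
`‖Y(z+e_μ,ν)‖, ‖Y(z+e_ν,μ)‖ ≤ S`. [folklore] -/
theorem norm_curlAt_smul_fun_sub_le [Nonempty n] {V : Site d → Fin d → (Matrix n n ℂ)ˣ} (hV : IsUnitaryCfg V) (χ : Site d → ℝ) (Y : Site d → Fin d → Matrix n n ℂ)
    (z : Site d) (μ ν : Fin d) {g S : ℝ} (hgμ : |χ (z + e μ) - χ z| ≤ g) (hgν : |χ (z + e ν) - χ z| ≤ g)
    (hS₁ : ‖Y (z + e μ) ν‖ ≤ S) (hS₂ : ‖Y (z + e ν) μ‖ ≤ S) :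
    ‖curlAt V (fun x κ => χ x • Y x κ) z μ ν - χ z • curlAt V Y z μ ν‖ ≤ 2 * g * S := by
  have hm : (V z μ * V (z + e μ) ν) ∈ unitaryUnits (Matrix n n ℂ) := (unitaryUnits _).mul_mem (hV z μ) (hV (z + e μ) ν)
  have hg0 : 0 ≤ g := (abs_nonneg _).trans hgμ
  rw [curlAt_smul_fun, add_sub_cancel_left]
  calc ‖(χ (z + e μ) - χ z) • Ad (V z μ * V (z + e μ) ν) (Y (z + e μ) ν) - (χ (z + e ν) - χ z) • Ad (V z μ * V (z + e μ) ν) (Y (z + e ν) μ)‖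
      ≤ ‖(χ (z + e μ) - χ z) • Ad (V z μ * V (z + e μ) ν) (Y (z + e μ) ν)‖ + ‖(χ (z + e ν) - χ z) • Ad (V z μ * V (z + e μ) ν) (Y (z + e ν) μ)‖ :=
        norm_sub_le _ _
    _ ≤ g * S + g * S := by
        rw [norm_smul, norm_smul, Real.norm_eq_abs, Real.norm_eq_abs, norm_Ad_of_unitary hm, norm_Ad_of_unitary hm]
        exact add_le_add (mul_le_mul hgμ hS₁ (norm_nonneg _) hg0) (mul_le_mul hgν hS₂ (norm_nonneg _) hg0)
    _ = 2 * g * S := by ring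

/-- **THE DIVERGENCE COMMUTATOR COSTS `d·|∇χ|·sup‖Y‖`** (every `V`): `‖div_V(χY)(x) − χ(x)·div_V Y(x)‖ ≤ d·g·S` when `|χ(x) − χ(x−e_μ)| ≤ g` and `‖Y(x−e_μ, μ)‖ ≤ S` for all `μ`.
[folklore] -/
theorem norm_covDiv_smul_fun_sub_le (V : Site d → Fin d → (Matrix n n ℂ)ˣ) (χ : Site d → ℝ) (Y : Site d → Fin d → Matrix n n ℂ) (x : Site d)
    {g S : ℝ} (hg : ∀ μ : Fin d, |χ x - χ (x - e μ)| ≤ g) (hS : ∀ μ : Fin d, ‖Y (x - e μ) μ‖ ≤ S) :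
    ‖covDiv V (fun y κ => χ y • Y y κ) x - χ x • covDiv V Y x‖ ≤ d * g * S := by
  rw [covDiv_smul_fun, add_sub_cancel_left]
  calc ‖∑ μ : Fin d, (χ x - χ (x - e μ)) • Y (x - e μ) μ‖ ≤ ∑ μ : Fin d, ‖(χ x - χ (x - e μ)) • Y (x - e μ) μ‖ := norm_sum_le _ _
    _ ≤ ∑ _μ : Fin d, g * S := Finset.sum_le_sum fun μ _ => by
        rw [norm_smul, Real.norm_eq_abs]
        exact mul_le_mul (hg μ) (hS μ) (norm_nonneg _) ((abs_nonneg _).trans (hg μ))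
    _ = d * g * S := by rw [Finset.sum_const, Finset.card_univ, Fintype.card_fin, nsmul_eq_mul]; ring

/-- The flat divergence commutator costs `d·g·S`. [folklore] -/
theorem norm_flatDiv_smul_fun_sub_le (χ : Site d → ℝ) (Y : Site d → Fin d → Matrix n n ℂ) (x : Site d)
    {g S : ℝ} (hg : ∀ μ : Fin d, |χ x - χ (x - e μ)| ≤ g) (hS : ∀ μ : Fin d, ‖Y (x - e μ) μ‖ ≤ S) :
    ‖flatDiv (fun y κ => χ y • Y y κ) x - χ x • flatDiv Y x‖ ≤ d * g * S := by
  rw [flatDiv_smul_fun, add_sub_cancel_left]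
  calc ‖∑ μ : Fin d, (χ x - χ (x - e μ)) • Y (x - e μ) μ‖ ≤ ∑ μ : Fin d, ‖(χ x - χ (x - e μ)) • Y (x - e μ) μ‖ := norm_sum_le _ _
    _ ≤ ∑ _μ : Fin d, g * S := Finset.sum_le_sum fun μ _ => by
        rw [norm_smul, Real.norm_eq_abs]
        exact mul_le_mul (hg μ) (hS μ) (norm_nonneg _) ((abs_nonneg _).trans (hg μ))
    _ = d * g * S := by rw [Finset.sum_const, Finset.card_univ, Fintype.card_fin, nsmul_eq_mul]; ring

/-- The gauge-direction commutator costs `g·‖λ(x+e_μ)‖`. [folklore] -/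
theorem norm_gaugeDir_smul_fun_sub_le (V : Site d → Fin d → (Matrix n n ℂ)ˣ) (χ : Site d → ℝ) (lam : Site d → Matrix n n ℂ) (x : Site d)
    (μ : Fin d) {g s : ℝ} (hg : |χ x - χ (x + e μ)| ≤ g) (hs : ‖lam (x + e μ)‖ ≤ s) :
    ‖gaugeDir V (fun y => χ y • lam y) x μ - χ x • gaugeDir V lam x μ‖ ≤ g * s := by
  rw [gaugeDir_smul_fun, add_sub_cancel_left, norm_smul, Real.norm_eq_abs]
  exact mul_le_mul hg hs (norm_nonneg _) ((abs_nonneg _).trans hg)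

/-- **THE STRAIGHT-AVERAGE COMMUTATOR COSTS `L·osc(χ)·sup‖Y‖`** (`L ≥ 1`): if `|χ(x) − t| ≤ ω` and `‖Y x κ‖ ≤ S` on the averaging region of `linQ L · q κ` (the `κ`-lines of length
`2L − 1` issuing from the block `[q, q + (L−1)]`), then `‖linQ L (χ•Y) q κ − t•linQ L Y q κ‖ ≤ L·ω·S`. [folklore] -/
theorem norm_linQ_smul_fun_sub_le {L : ℕ} (hL : 1 ≤ L) (χ : Site d → ℝ) (t : ℝ) (Y : Site d → Fin d → Matrix n n ℂ) (q : Site d) (κ : Fin d)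
    {ω S : ℝ}
    (hω : ∀ x : Site d, q ≤ x → (∀ i, i ≠ κ → x i ≤ q i + ((L : ℤ) - 1)) → x κ ≤ q κ + 2 * ((L : ℤ) - 1) → |χ x - t| ≤ ω)
    (hS : ∀ x : Site d, q ≤ x → (∀ i, i ≠ κ → x i ≤ q i + ((L : ℤ) - 1)) → x κ ≤ q κ + 2 * ((L : ℤ) - 1) → ‖Y x κ‖ ≤ S) :
    ‖linQ L (fun y μ => χ y • Y y μ) q κ - t • linQ L Y q κ‖ ≤ L * (ω * S) := by
  rw [linQ_smul_fun L χ t, add_sub_cancel_left]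
  refine norm_linQ_le_of_block hL _ q κ fun x h1 h2 h3 => ?_
  rw [norm_smul, Real.norm_eq_abs]
  exact mul_le_mul (hω x h1 h2 h3) (hS x h1 h2 h3) (norm_nonneg _) ((abs_nonneg _).trans (hω x h1 h2 h3))

end

end Summit.QuantumFields.BalabanUV.T4Continuum.NE7CutoffLeibniz
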